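import Summits.ABC.IUTFork.LanaDegrees
import Summits.ABC.IUTFork.ForkHexagon
import HarnessLib

/-!
# L-LANA objects VIII bis: the printed `q`-pilot local degrees instantiate the skeleton's `LocalDegrees` (XIV)

Record-only file (D-0012) of the abc-iut cell (seat abc-iut-c312-4, L-LANA level, N7 ↔ skel XIV bridge);
TAKES NO SIDE on [IUTchIII] Cor. 3.12. `ForkHexagon.lean` (XIV) takes the local degrees `d_v > 0` of LANA
§4.2 (c)'s `q`-pilot value-group BPS as an abstract datum `LocalDegrees`; `LanaDegrees.lean` DEFINED them
over a number field (`deg(q̲_v)`, `deg(p_v)`, `2π`, Mathlib `NumberField`/`FinitePlace`). This file is the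
15-line bridge: `QPilotInput.toLocalDegrees`, so that every theorem of XIV (the `q`-pilot and Θ-pilot BPSs, the
Θ-link's value-group portion `thetaLink` and its uniqueness, `hexagon_theta_route`/`hexagon_not_commute` —
LANA §10.2 p. 47 "scales by a factor of `(1/ℓ⋇)(1² + ⋯ + (ℓ⋇)²)`", §10.5 "we concur that the diagram in
Figure 7 does not commute") holds for the PRINTED pilots of a number field, with the single remaining input
`ord_v(q_v) > 0` (Tate parameter; [IUTchI] Def. 3.1 (b)). [cite: LANA2026Report, §4.2 (c) p. 26, §10.2 p. 47]
NOT here: any judgement.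
-/

noncomputable section

namespace Summit.ABC
namespace IUTFork
namespace QPilotInput

open NumberField

variable {F : Type} [Field F] [NumberField F] (Q : QPilotInput F)

/-- **The bridge N7 → XIV**: the printed local degrees as a `LocalDegrees` datum (`d_v`, positivity,
`V^bad ≠ ∅`, `ℓ⋇ = (l−1)/2 ≥ 2`). [cite: LANA2026Report, §4.2 (c) p. 26] -/
def toLocalDegrees : LocalDegrees Q.V Q.badIn where
  d := Q.d
  d_pos := Q.d_pos
  bad_nonempty := Q.badIn_nonempty
  lstar := (Q.l - 1) / 2
  two_le_lstar := Q.two_le_lstar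

/-- The `q`-pilot BPS of XIV built on the printed degrees has pilot `Σ_{v ∈ V^bad} deg(q̲_v)`.
[cite: LANA2026Report, §4.2 (c) p. 26] -/
theorem toLocalDegrees_qBPS_pilot : Q.toLocalDegrees.qBPS.pilot = ∑ v ∈ Q.badIn, Q.d v := rfl

/-- LANA §10.5 for the PRINTED pilots of a number field: on the Θ-pilot, the Θ-side degree is
`s · Σ_{bad} deg(q̲_v)` while the route through the Θ-link gives `Σ_{bad} deg(q̲_v)` — they differ
("we concur that the diagram in Figure 7 does not commute"; XIV `hexagon_not_commute`, instantiated).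
[cite: LANA2026Report, §10.5 p. 49] -/
theorem hexagon_not_commute_printed :
    Q.toLocalDegrees.thetaDeg Q.toLocalDegrees.s_pos (Q.toLocalDegrees.thetaBPS Q.toLocalDegrees.s_pos).pilot ≠
      Q.toLocalDegrees.qDeg ((Q.toLocalDegrees.thetaLink Q.toLocalDegrees.s_pos).toEquiv
        (Q.toLocalDegrees.thetaBPS Q.toLocalDegrees.s_pos).pilot) :=
  Q.toLocalDegrees.hexagon_not_commute.2.2

end QPilotInput
end IUTFork
end Summit.ABC

end
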